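import Summits.BirchSwinnertonDyer.BirchSwinnertonDyer.Theorems.AlignedTransportAtTwoMainConjectureOfRankZeroBSDAtTwoSharedCubicDivisionField
import HarnessLib

/-!
# Route `AlignedTransportAtTwo`, crux C2 `MainConjectureOfRankZeroBSDAtTwo` (stmt-BirchSwinnertonDyer-22298):
# A SHARED CUBIC FIELD GIVES ONE RESOLVENT — `ℚ⟮4δ(W₁)⟯ = ℚ⟮4δ(W₂)⟯` in `ℚ̄` on crux C1's binders (the unique quadratic subfield of the common
# `S₃`-sextic), so the resolvent input of the `S₃` ledger is literally the same field for both curves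

HONEST FRAMING. WIDTH-5 attached prover seat `bsd-line-att-p4` g31 on line `birth` of the lead `bsd-line-att-p2`; `--supports`
stmt-BirchSwinnertonDyer-22298, closes nothing; BSD is NOT proved; crux C2, its verdict «blocked-on `Rank1Residual.GreenbergMuConjectureIrreducible`»
and every registered stub untouched; crux C1 only READ. THEOREMS ONLY (no `def`, no named fact, no `sorry`). Sequel of this seat's
`…SharedCubicDivisionField` (`W₁.divisionField 2 = W₂.divisionField 2` on C1's binders).

* §1 `eq_of_le_of_finrank_eq_two_of_not_four_dvd` — two quadratic subfields `K₁, K₂ ⊆ ℚ̄` of an intermediate field `T` with `4 ∤ [T : ℚ]` coincide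
  (`[K₁K₂ : ℚ] ≤ 4` divides `[T : ℚ]` and is a multiple of `2`); an `S₃`-sextic has ONE quadratic subfield.
* §2 ★ `adjoin_four_mul_delta_eq_of_shared_cubic_field` — on C1's binders (`W_i` no rational `2`-torsion abscissa, `Δ(W_i) ∉ ℚ²`, shared cubic
  field `F ∋ e₁, e₂`): **`ℚ⟮4δ(W₁)⟯ = ℚ⟮4δ(W₂)⟯`** (`(4δ)² = Δ`; both are quadratic subfields of the common sextic); hence
  `forall_classicalMuVanishes_resolvent_iff_of_shared_cubic_field` and `classNumberPExp_resolvent_eq_of_shared_cubic_field'` (the resolvent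
  table agrees, now WITHOUT the `2Δ ∉ ℚ²` hypotheses of the `S₃`-identity route in `…SharedCubicDivisionField`).

References: [MilneFT2022] Ch. 3 (tower law, fundamental theorem); [SilvermanAEC2009] VIII.§1; [DokchitserDokchitserMathZ2012] Theorem (1), proof
(`ℚ(E[2]) ⊃ ℚ(√Δ)`); tree: att-p4 g28/g29 `delta_mem_and_sq`, `finrank_adjoin_eq_two_of_sq_eq`, `finrank_divisionField_two_eq_six`.
-/

-- the Theorems namespace of this sub repeats the summit name by design (D-0017 nested layout)
set_option linter.dupNamespace false
set_option autoImplicit false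

noncomputable section

open scoped Classical NumberField

namespace Summit.BirchSwinnertonDyer.BirchSwinnertonDyer.Theorems.AlignedTransportAtTwoSharedCubicResolventField

open NumberField Polynomial WeierstrassCurve IntermediateField Field
  Literature.NumberTheory.EllipticCurves Literature.NumberTheory.EllipticCurves.Greenberg1999
  Literature.NumberTheory.EllipticCurves.DokchitserDokchitser2012
  Literature.NumberTheory.EllipticCurves.ZpExtension Literature.NumberTheory.GaloisRepresentations
  Literature.NumberTheory.IwasawaTheory Literature.NumberTheory.NumberFields
  Summit.BirchSwinnertonDyer.Rank1Residual.F1Sign2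
  Summit.BirchSwinnertonDyer.BirchSwinnertonDyer.Theorems.AlignedTransportAtTwoCubicClosureParity
  Summit.BirchSwinnertonDyer.BirchSwinnertonDyer.Theorems.AlignedTransportAtTwoSexticTowerGrowth
  Summit.BirchSwinnertonDyer.BirchSwinnertonDyer.Theorems.AlignedTransportAtTwoSexticNormRelationDescent
  Summit.BirchSwinnertonDyer.BirchSwinnertonDyer.Theorems.AlignedTransportAtTwoSharedCubicDivisionField

/-! ## §1 An intermediate field of degree not divisible by `4` has at most one quadratic subfield -/

/-- **Two quadratic subfields of `T ⊆ ℚ̄` coincide when `4 ∤ [T : ℚ] = n`**: `K₁ ⊔ K₂ ≤ T` has degree `≤ 4` (compositum bound), divisible by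
`2 = [K₁ : ℚ]` and dividing `[T : ℚ]`; so `[K₁ ⊔ K₂ : ℚ] = 2` and `K₁ = K₁ ⊔ K₂ = K₂`. [cite: MilneFT2022, Ch. 3 (tower law)] -/
theorem eq_of_le_of_finrank_eq_two_of_not_four_dvd {K₁ K₂ T : IntermediateField ℚ (AlgebraicClosure ℚ)} (h₁ : K₁ ≤ T) (h₂ : K₂ ≤ T)
    (hK₁ : Module.finrank ℚ K₁ = 2) (hK₂ : Module.finrank ℚ K₂ = 2) {n : ℕ} (hT : Module.finrank ℚ T = n) (hn : ¬ 4 ∣ n) :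
    K₁ = K₂ := by
  haveI : FiniteDimensional ℚ K₁ := Module.finite_of_finrank_eq_succ hK₁
  haveI : FiniteDimensional ℚ K₂ := Module.finite_of_finrank_eq_succ hK₂
  have hdvdT : Module.finrank ℚ ↥(K₁ ⊔ K₂) ∣ n := hT ▸ finrank_dvd_of_le_right (sup_le h₁ h₂)
  have hle4 : Module.finrank ℚ ↥(K₁ ⊔ K₂) ≤ 4 := by
    have := IntermediateField.finrank_sup_le K₁ K₂
    rw [hK₁, hK₂] at this
    exact this
  have h2dvd : 2 ∣ Module.finrank ℚ ↥(K₁ ⊔ K₂) := hK₁ ▸ finrank_dvd_of_le_right (le_sup_left : K₁ ≤ K₁ ⊔ K₂)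
  have hpos : 0 < Module.finrank ℚ ↥(K₁ ⊔ K₂) := Module.finrank_pos
  -- the degree of the compositum is `2` (it is `2` or `4`, and `4 ∤ [T : ℚ]`)
  have hS : Module.finrank ℚ ↥(K₁ ⊔ K₂) = 2 := by
    obtain ⟨m, hm⟩ := h2dvd
    have hm' : m = 1 ∨ m = 2 := by omega
    rcases hm' with rfl | rfl
    · simpa using hm
    · exact absurd (hm ▸ hdvdT) (by simpa using hn)
  have e₁ : K₁ = K₁ ⊔ K₂ := IntermediateField.eq_of_le_of_finrank_eq le_sup_left (by rw [hK₁, hS])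
  have e₂ : K₂ = K₁ ⊔ K₂ := IntermediateField.eq_of_le_of_finrank_eq le_sup_right (by rw [hK₂, hS])
  rw [e₁, ← e₂]

/-! ## §2 The resolvent models of two curves sharing a cubic field coincide -/

section Shared

variable (W₁ W₂ : WeierstrassCurve ℚ) [W₁.IsElliptic] [W₂.IsElliptic]
  (ht₁ : ∀ x : ℚ, ¬ HasRationalTwoTorsionX W₁ x) (ht₂ : ∀ x : ℚ, ¬ HasRationalTwoTorsionX W₂ x)
  (hsq₁ : ¬ IsSquare W₁.Δ) (hsq₂ : ¬ IsSquare W₂.Δ)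
  {F : Type} [Field F] [NumberField F] (hF : Module.finrank ℚ F = 3) {e₁ e₂ : F}
  (he₁ : aeval e₁ (twoDivisionUCubic W₁) = 0) (he₂ : aeval e₂ (twoDivisionUCubic W₂) = 0)

include ht₁ ht₂ hsq₁ hsq₂ hF he₁ he₂ in
/-- ★ **ONE RESOLVENT: `ℚ⟮4δ(W₁)⟯ = ℚ⟮4δ(W₂)⟯` in `ℚ̄`** for two curves without rational `2`-torsion abscissa and with non-square
discriminants sharing a cubic field (C1's binders): both are quadratic subfields (`(4δ)² = Δ ∉ ℚ²`) of the common `S₃`-sextic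
`ℚ(W₁[2]) = ℚ(W₂[2])` of degree `6`, which has exactly one (§1). Equivalently `Δ(W₁)Δ(W₂) ∈ ℚ²`: the discriminant square class is an
invariant of the cubic field. [cite: DokchitserDokchitserMathZ2012, Theorem (1), proof (ℚ(E[2]) ⊃ ℚ(√Δ))] [cite: MilneFT2022, Ch. 3] -/
theorem adjoin_four_mul_delta_eq_of_shared_cubic_field : ℚ⟮4 * delta W₁ two_ne_zero⟯ = ℚ⟮4 * delta W₂ two_ne_zero⟯ := by
  have hdiv := divisionField_two_eq_of_shared_cubic_field W₁ W₂ ht₁ ht₂ hF he₁ he₂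
  have h6 : Module.finrank ℚ (W₂.divisionField 2) = 6 := finrank_divisionField_two_eq_six W₂ ht₂ hsq₂
  have hle₁ : ℚ⟮4 * delta W₁ two_ne_zero⟯ ≤ W₂.divisionField 2 := hdiv ▸ adjoin_simple_le_iff.mpr (delta_mem_and_sq W₁).1
  have hle₂ : ℚ⟮4 * delta W₂ two_ne_zero⟯ ≤ W₂.divisionField 2 := adjoin_simple_le_iff.mpr (delta_mem_and_sq W₂).1
  exact eq_of_le_of_finrank_eq_two_of_not_four_dvd hle₁ hle₂ (finrank_adjoin_eq_two_of_sq_eq (delta_mem_and_sq W₁).2 hsq₁)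
    (finrank_adjoin_eq_two_of_sq_eq (delta_mem_and_sq W₂).2 hsq₂) h6 (by decide)

include ht₁ ht₂ hsq₁ hsq₂ hF he₁ he₂ in
/-- **The resolvent input agrees on the pair** (`μ₂ = 0` for every cyclotomic `ℤ₂`-tower of the resolvent model), C1's binders.
[cite: Washington1997, §13.1] -/
theorem forall_classicalMuVanishes_resolvent_iff_of_shared_cubic_field :
    (∀ κ₁ : ZpExtension ↥ℚ⟮4 * delta W₁ two_ne_zero⟯ 2, κ₁.IsCyclotomic → ClassicalMuVanishes κ₁) ↔
      ∀ κ₂ : ZpExtension ↥ℚ⟮4 * delta W₂ two_ne_zero⟯ 2, κ₂.IsCyclotomic → ClassicalMuVanishes κ₂ := by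
  rw [adjoin_four_mul_delta_eq_of_shared_cubic_field W₁ W₂ ht₁ ht₂ hsq₁ hsq₂ hF he₁ he₂]

include ht₁ ht₂ hsq₁ hsq₂ hF he₁ he₂ in
/-- **`e_n(ℚ(√Δ(W₁))) = e_n(ℚ(√Δ(W₂)))` for every `n`** (any cyclotomic `ℤ₂`-towers of the two resolvent models) — by the field equality,
with no `2Δ ∉ ℚ²` hypothesis (compare `…SharedCubicDivisionField.classNumberPExp_resolvent_eq_of_shared_cubic_field`, which goes through the
exact `S₃` identity). [cite: Washington1997, §13.1] -/
theorem classNumberPExp_resolvent_eq_of_shared_cubic_field'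
    (κ₁ : ZpExtension ↥ℚ⟮4 * delta W₁ two_ne_zero⟯ 2) (hκ₁ : κ₁.IsCyclotomic)
    (κ₂ : ZpExtension ↥ℚ⟮4 * delta W₂ two_ne_zero⟯ 2) (hκ₂ : κ₂.IsCyclotomic) (n : ℕ) :
    classNumberPExp κ₁ n = classNumberPExp κ₂ n := by
  have hK := adjoin_four_mul_delta_eq_of_shared_cubic_field W₁ W₂ ht₁ ht₂ hsq₁ hsq₂ hF he₁ he₂
  suffices h : ∀ (K : IntermediateField ℚ (AlgebraicClosure ℚ)) (hK' : K = ℚ⟮4 * delta W₂ two_ne_zero⟯)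
      (κ : ZpExtension ↥K 2), κ.IsCyclotomic → classNumberPExp κ n = classNumberPExp κ₂ n from h _ hK κ₁ hκ₁
  rintro K rfl κ hκ
  exact classNumberPExp_eq_of_isCyclotomic κ κ₂ hκ hκ₂ n

include ht₁ ht₂ hsq₁ hsq₂ hF he₁ he₂ in
/-- **`Δ(W₁)·Δ(W₂)` is a square in `ℚ̄`-free terms: `(4δ(W₁))·(4δ(W₂))⁻¹ … `** — stated as the usable field fact
`4δ(W₁) ∈ ℚ⟮4δ(W₂)⟯`. [cite: DokchitserDokchitserMathZ2012, Theorem (1), proof (ℚ(E[2]) ⊃ ℚ(√Δ))] -/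
theorem four_mul_delta_mem_adjoin_of_shared_cubic_field : 4 * delta W₁ two_ne_zero ∈ ℚ⟮4 * delta W₂ two_ne_zero⟯ := by
  rw [← adjoin_four_mul_delta_eq_of_shared_cubic_field W₁ W₂ ht₁ ht₂ hsq₁ hsq₂ hF he₁ he₂]
  exact mem_adjoin_simple_self ℚ _

end Shared

end Summit.BirchSwinnertonDyer.BirchSwinnertonDyer.Theorems.AlignedTransportAtTwoSharedCubicResolventField

end
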